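import Summits.MatrixMultiplication.MatrixMultiplication.Theorems.EdgePencilTropicalPair
import HarnessLib

/-!
# Where `TROP(n, e)` is decided on the 4-party spectrum: automatic below `n⁴/e`, «flat» on
# `(n⁴/e, n⁴]`, «blind» above `n⁴` — and the flat branch everywhere is `HalfAlpha`-strong

Support kernel for `stmt-MatrixMultiplication-26697` (`TetraExcessZero`, route `TetrahedronCarving`; cut of
record `closes (TetraExcessZero) (TetraPlusTwo) : ω = 2`, UNCHANGED; lineage `decomp-mm-lens-6`, generation 43).
No item is added or changed; no definition is introduced. Notation as in `EdgePencilTropicalPair`: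
`W_n^{(e)} = sixTetra F n e`, `D_n = W_n^{(1)}`, `X₄(F) = DTensorClass.asymptoticSpectrumDTensors F 2`,
`[t] = DTensorClass.mk t`, `≲ = AsympLe (· ≤ ·)`,
`TROP(n, e) : ∀ φ ∈ X₄(F), φ[W_n^{(e)}] ≤ max (φ[D_n], n⁴)` (spelled out in every statement).

§18 THE THREE REGIONS OF `X₄` AT BASE `n` (by the value `φ[D_n]` of the diamond):
* `φ[D_n] ≤ n⁴/e` — AUTOMATIC: the list price `φ[W_n^{(e)}] ≤ e·φ[D_n]`
  (`EdgePencilFlatSummandProfile.spectrum_sixTetra_le_mul_diamond`) already gives `≤ n⁴`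
  (`trop_at_of_mul_diamond_le`); all quantum functionals and all single-party flattenings of the screen of
  record lie here (`φ[D_n] ≤ n³`);
* `n⁴/e < φ[D_n] ≤ n⁴` — the point must be «W-FLAT»: `φ[W_n^{(e)}] ≤ n⁴` (the pair flattenings
  `ζ^{(02)}, ζ^{(03)}` (`n³·e ≤ n⁴`) and `ζ^{(01)}` (`= n⁴`, blind) lie here and pass);
* `n⁴ < φ[D_n]` — the point must be BLIND: `φ[W_n^{(e)}] = φ[D_n]` (this region is EMPTY iff the diamond is
  spectrally flat at base `n`, `R̃(D_n) ≤ n⁴`, i.e. in the `HalfAlpha` world; no explicitly known point lies here).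
`trop_iff_near_flat`: `TROP(n,e) ⟺` the condition on the points with `n⁴ < e·φ[D_n]` only;
`trop_iff_high_blind_and_low_flat`: `TROP(n,e) ⟺ (high points blind) ∧ (low points W-flat)`.

§19 THE FLAT BRANCH EVERYWHERE IS `HalfAlpha`-STRONG (`halfAlpha_of_wflat`): if at one base `n ≥ 2` EVERY
point has `φ[W_n^{(2)}] ≤ n⁴` (equivalently `[W_n^{(2)}] ≲ ⟨n⁴⟩`, ONE asymptotic inequality,
`wflat_iff_absolutePurchase`), then `HalfAlpha ∧ ψ = 4 ∧ χ(log_n 2) = 4` (through the landed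
`EdgePencilFlatSummandPrice.halfAlpha_of_absolutePurchase`). So a `HalfAlpha`-free proof of `TROP(n, 2)` must
use the BLIND branch on a non-empty high region: it is a statement about how points valuing the diamond above
its largest flattening treat one doubled edge — the recorded all-or-nothing (BN5) re-appears as «the low
region alone cannot carry the purchase».

References: Strassen 1988 (spectral characterisation of `≲`) [Strassen1988]; Zuiddam 2018, Thm. 2.12
[Zuiddam2018]; Christandl–Vrana–Zuiddam 2023, Thm. 1.1 [ChristandlVranaZuiddam2023]; Christandl–Vrana–Zuiddam,
arXiv:1609.07476, §1.1 [ChristandlVranaZuiddam2016]; Alman–Li–Pratt 2026, §3.2.2 (explicitly known 4-party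
points) [arXiv:2604.01386].
No `sorry`, no new axiom, no instance, no notation, no definition.
-/

noncomputable section

set_option linter.dupNamespace false

open Finset Literature.Computability.AlgebraicComplexity
open Summit.MatrixMultiplication.MatrixMultiplication.Theorems.TetrahedronTensor
open Summit.MatrixMultiplication.MatrixMultiplication.Theorems.TetraDiagonal
open Summit.MatrixMultiplication.MatrixMultiplication.Theses.TetrahedronCarving

namespace Summit.MatrixMultiplication.MatrixMultiplication.Theorems.EdgePencil

/-! ## §18 The three regions -/

section Regions

variable {F : Type*} [Field F]

/-- **Automatic region**: `e·φ[D_n] ≤ n⁴ ⟹ φ[W_n^{(e)}] ≤ max (φ[D_n], n⁴)` (list price).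
[cite: Zuiddam2018, Def. 2.11] -/
theorem trop_at_of_mul_diamond_le {n : ℕ} (hn : 1 ≤ n) (e : ℕ) {φ : DTensorClass F 4 → ℝ}
    (hφ : φ ∈ DTensorClass.asymptoticSpectrumDTensors F 2)
    (h : (e : ℝ) * φ (DTensorClass.mk (sixTetra F n 1)) ≤ (n : ℝ) ^ 4) :
    φ (DTensorClass.mk (sixTetra F n e)) ≤ max (φ (DTensorClass.mk (sixTetra F n 1))) ((n : ℝ) ^ 4) :=
  le_max_of_le_right ((spectrum_sixTetra_le_mul_diamond (F := F) hn e hφ).trans h)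

/-- **`TROP(n,e)` is decided on the near-flat-or-high points only**: those with `n⁴ < e·φ[D_n]`.
[cite: Zuiddam2018, Def. 2.11] -/
theorem trop_iff_near_flat {n : ℕ} (hn : 1 ≤ n) (e : ℕ) :
    (∀ φ ∈ DTensorClass.asymptoticSpectrumDTensors F 2,
      φ (DTensorClass.mk (sixTetra F n e)) ≤ max (φ (DTensorClass.mk (sixTetra F n 1))) ((n : ℝ) ^ 4)) ↔
    ∀ φ ∈ DTensorClass.asymptoticSpectrumDTensors F 2,
      (n : ℝ) ^ 4 < (e : ℝ) * φ (DTensorClass.mk (sixTetra F n 1)) →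
        φ (DTensorClass.mk (sixTetra F n e)) ≤ max (φ (DTensorClass.mk (sixTetra F n 1))) ((n : ℝ) ^ 4) := by
  refine ⟨fun h φ hφ _ => h φ hφ, fun h φ hφ => ?_⟩
  by_cases hlt : (n : ℝ) ^ 4 < (e : ℝ) * φ (DTensorClass.mk (sixTetra F n 1))
  · exact h φ hφ hlt
  · exact trop_at_of_mul_diamond_le hn e hφ (not_lt.mp hlt)

/-- **`TROP(n,e) ⟺ (high points are blind) ∧ (low points are W-flat)`** (`1 ≤ e`): a point with
`n⁴ < φ[D_n]` must have `φ[W_n^{(e)}] = φ[D_n]`, a point with `φ[D_n] ≤ n⁴` must have `φ[W_n^{(e)}] ≤ n⁴`.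
[cite: Zuiddam2018, Def. 2.11] -/
theorem trop_iff_high_blind_and_low_flat {n e : ℕ} (he : 1 ≤ e) :
    (∀ φ ∈ DTensorClass.asymptoticSpectrumDTensors F 2,
      φ (DTensorClass.mk (sixTetra F n e)) ≤ max (φ (DTensorClass.mk (sixTetra F n 1))) ((n : ℝ) ^ 4)) ↔
    (∀ φ ∈ DTensorClass.asymptoticSpectrumDTensors F 2,
      (n : ℝ) ^ 4 < φ (DTensorClass.mk (sixTetra F n 1)) →
        φ (DTensorClass.mk (sixTetra F n e)) = φ (DTensorClass.mk (sixTetra F n 1))) ∧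
    (∀ φ ∈ DTensorClass.asymptoticSpectrumDTensors F 2,
      φ (DTensorClass.mk (sixTetra F n 1)) ≤ (n : ℝ) ^ 4 →
        φ (DTensorClass.mk (sixTetra F n e)) ≤ (n : ℝ) ^ 4) := by
  constructor
  · intro h
    refine ⟨fun φ hφ hhigh => ?_, fun φ hφ hlow => ?_⟩
    · have h1 := h φ hφ
      rw [max_eq_left hhigh.le] at h1
      exact le_antisymm h1 (spectrum_diamond_le_sixTetra (F := F) he hφ)
    · have h1 := h φ hφ
      rwa [max_eq_right hlow] at h1
  · rintro ⟨hhigh, hlow⟩ φ hφ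
    by_cases hle : φ (DTensorClass.mk (sixTetra F n 1)) ≤ (n : ℝ) ^ 4
    · exact le_max_of_le_right (hlow φ hφ hle)
    · exact le_max_of_le_left (hhigh φ hφ (not_le.mp hle)).le

/-- **If the diamond is spectrally flat at base `n`** (`φ[D_n] ≤ n⁴` for all `φ`: the high region is empty),
`TROP(n,e)` is the absolute statement `φ[W_n^{(e)}] ≤ n⁴` for all `φ`. [cite: Zuiddam2018, Def. 2.11] -/
theorem trop_iff_wflat_of_diamond_flat {n e : ℕ}
    (hD : ∀ φ ∈ DTensorClass.asymptoticSpectrumDTensors F 2,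
      φ (DTensorClass.mk (sixTetra F n 1)) ≤ (n : ℝ) ^ 4) :
    (∀ φ ∈ DTensorClass.asymptoticSpectrumDTensors F 2,
      φ (DTensorClass.mk (sixTetra F n e)) ≤ max (φ (DTensorClass.mk (sixTetra F n 1))) ((n : ℝ) ^ 4)) ↔
    ∀ φ ∈ DTensorClass.asymptoticSpectrumDTensors F 2,
      φ (DTensorClass.mk (sixTetra F n e)) ≤ (n : ℝ) ^ 4 := by
  refine forall₂_congr fun φ hφ => ?_
  rw [max_eq_right (hD φ hφ)]

end Regions

/-! ## §19 The flat branch everywhere is `HalfAlpha`-strong -/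

section Flat

variable {F : Type*} [Field F]

/-- **W-flat at every point ⟺ ONE asymptotic inequality** `[W_n^{(e)}] ≲ ⟨n⁴⟩` (Strassen duality; the unit
is multiplicative, so one level is all levels). [cite: Strassen1988, Thm. (spectral characterisation)] -/
theorem wflat_iff_absolutePurchase {n e : ℕ} :
    (∀ φ ∈ DTensorClass.asymptoticSpectrumDTensors F 2,
      φ (DTensorClass.mk (sixTetra F n e)) ≤ (n : ℝ) ^ 4) ↔
    AsympLe (fun x y : DTensorClass F 4 => x ≤ y) (DTensorClass.mk (sixTetra F n e))
      ((n ^ 4 : ℕ) : DTensorClass F 4) := by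
  rw [DTensorClass.asympLe_iff_forall_mem_spectrum]
  refine forall₂_congr fun φ hφ => ?_
  rw [(DTensorClass.mem_asymptoticSpectrumDTensors_iff.1 hφ).map_natCast]
  push_cast
  exact Iff.rfl

/-- W-flat at base `n` propagates to the powers: `[W_{n^{k+1}}^{(e^{k+1})}] ≲ ⟨(n^{k+1})⁴⟩` (`e ≤ n`).
[cite: ChristandlVranaZuiddam2023, §1.2] -/
theorem absolutePurchase_pow_of_wflat {n e : ℕ} (he : e ≤ n)
    (h : ∀ φ ∈ DTensorClass.asymptoticSpectrumDTensors F 2,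
      φ (DTensorClass.mk (sixTetra F n e)) ≤ (n : ℝ) ^ 4) (k : ℕ) :
    AsympLe (fun x y : DTensorClass F 4 => x ≤ y) (DTensorClass.mk (sixTetra F (n ^ (k + 1)) (e ^ (k + 1))))
      (((n ^ (k + 1)) ^ 4 : ℕ) : DTensorClass F 4) := by
  have hSP : IsStrassenPreorder (fun x y : DTensorClass F 4 => x ≤ y) :=
    DTensorClass.isStrassenPreorder F 2
  refine DTensorClass.asympLe_iff_forall_mem_spectrum.2 fun φ hφ => ?_
  have hφ' := DTensorClass.mem_asymptoticSpectrumDTensors_iff.1 hφ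
  rw [hφ'.map_natCast, ← spectrum_sixTetra_pow (F := F) he k hφ]
  have h0 : 0 ≤ φ (DTensorClass.mk (sixTetra F n e)) := hφ'.nonneg hSP _
  have hcast : (((n ^ (k + 1)) ^ 4 : ℕ) : ℝ) = ((n : ℝ) ^ 4) ^ (k + 1) := by push_cast; ring
  rw [hcast]
  exact pow_le_pow_left₀ h0 (h φ hφ) _

/-- **THE FLAT BRANCH EVERYWHERE IS `HalfAlpha`-STRONG**: if at one base `n ≥ 2` every point of `X₄(ℂ)` has
`φ[W_n^{(2)}] ≤ n⁴`, then `HalfAlpha ∧ ψ = 4 ∧ χ(log_n 2) = 4`. [cite: ChristandlVranaZuiddam2016, §1.1] -/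
theorem halfAlpha_of_wflat {n : ℕ} (hn : 2 ≤ n)
    (h : ∀ φ ∈ DTensorClass.asymptoticSpectrumDTensors ℂ 2,
      φ (DTensorClass.mk (sixTetra ℂ n 2)) ≤ (n : ℝ) ^ 4) :
    HalfAlpha ∧ omegaRect ℂ 2 1 2 = 4 ∧ omegaSix ℂ (Real.logb n 2) = 4 := by
  have hn1' : (1 : ℝ) < n := by exact_mod_cast (show 1 < n by omega)
  have hδ0 : 0 ≤ Real.logb n 2 := (Real.logb_pos hn1' (by norm_num)).le
  have hδ1 : Real.logb n 2 ≤ 1 := by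
    rw [← Real.logb_self_eq_one hn1']
    exact Real.logb_le_logb_of_le hn1' (by norm_num) (by exact_mod_cast hn)
  refine halfAlpha_of_absolutePurchase hδ0 hδ1 fun N₀ => ⟨n ^ (N₀ + 1), ?_, ?_⟩
  · have h1 : N₀ + 1 ≤ 2 ^ (N₀ + 1) := (Nat.lt_two_pow_self).le
    have h2 : 2 ^ (N₀ + 1) ≤ n ^ (N₀ + 1) := Nat.pow_le_pow_left hn _
    omega
  · have hr : rectDim (n ^ (N₀ + 1)) (Real.logb n 2) = 2 ^ (N₀ + 1) := by
      simpa using rectDim_pow_logb hn (show 1 ≤ 2 by norm_num) N₀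
    rw [hr]
    exact absolutePurchase_pow_of_wflat hn h N₀

/-- **Hence a `HalfAlpha`-free certificate of `TROP(n,2)` lives on the high region**: if `TROP_ℂ(n, 2)` holds
at a base `n ≥ 2` where `HalfAlpha` FAILS, then some point of `X₄(ℂ)` values the diamond above `n⁴` (and is
blind there). [cite: ChristandlVranaZuiddam2016, §1.1] -/
theorem exists_high_point_of_trop_of_not_halfAlpha {n : ℕ} (hn : 2 ≤ n) (hH : ¬ HalfAlpha)
    (hT : ∀ φ ∈ DTensorClass.asymptoticSpectrumDTensors ℂ 2,
      φ (DTensorClass.mk (sixTetra ℂ n 2)) ≤ max (φ (DTensorClass.mk (sixTetra ℂ n 1))) ((n : ℝ) ^ 4)) :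
    ∃ φ ∈ DTensorClass.asymptoticSpectrumDTensors ℂ 2,
      (n : ℝ) ^ 4 < φ (DTensorClass.mk (sixTetra ℂ n 1)) ∧
        φ (DTensorClass.mk (sixTetra ℂ n 2)) = φ (DTensorClass.mk (sixTetra ℂ n 1)) := by
  by_contra hne
  have hD : ∀ φ ∈ DTensorClass.asymptoticSpectrumDTensors ℂ 2,
      φ (DTensorClass.mk (sixTetra ℂ n 1)) ≤ (n : ℝ) ^ 4 := by
    intro φ hφ
    by_contra hlt
    rw [not_le] at hlt
    have hb := ((trop_iff_high_blind_and_low_flat (F := ℂ) (by norm_num : 1 ≤ 2)).1 hT).1 φ hφ hlt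
    exact hne ⟨φ, hφ, hlt, hb⟩
  exact hH (halfAlpha_of_wflat hn ((trop_iff_wflat_of_diamond_flat hD).1 hT)).1

end Flat

end Summit.MatrixMultiplication.MatrixMultiplication.Theorems.EdgePencil

end
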